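import Summits.PneNP.PneNP.Theorems.SymmetryBudgetNoHiddenOrderReplayAtomDefs
import Summits.PneNP.PneNP.Theorems.SymmetryBudgetNoHiddenOrderKitBridges

/-!
# `NoHiddenOrder` (stmt-PneNP-14781), (R2c) replay circuit I: the ATOM module — semantics

Route `PneNP/SymmetryBudget`; definitions in `SymmetryBudgetNoHiddenOrderReplayAtomDefs.lean`.
If the shared wires of an atom module `AI : AtomIter P V N T J` read the graph `G`, the kernel of the colouring
`col` ON THE START BLOCK `A` (nothing is asked off `A`: the colouring of a replayed state is only known on its
block) and the start block itself, with `|A|² ≤ N` and `|A| ≤ T`, then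

* `AtomIter.memW_iff_iterate` — the membership wires entering round `j ≤ J` read the `j`-th iterate
  `(B ↦ swReach G B col ptr)^[j] A` (switching gadget ⇒ `swGraph` of the block by `swGraph_adj_iff_induce`;
  reachability gadget ⇒ `swReach` by `mem_swReach_iff_reflTransGen`);
* `AtomIter.memW_last_iff_atom` — with `|A| + 1 ≤ J` the OUTPUT membership wires read the atom
  `BranchSum.atom G A col ptr` of the pointer;
* `AtomIter.Reads.memW_last_iff_atom` — the same from the bundled (stronger, global-kernel) reading.
Sorry-free; supports stmt-PneNP-14781, does not close it.
-/

set_option linter.dupNamespace false -- `Summit.PneNP.PneNP.…` (D-0017 single-conjunct layout)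

namespace Summit.PneNP.PneNP.Theorems

open Finset Literature.Computability.Complexity Literature.Computability.Complexity.SymProg

namespace AtomIter

variable {ι Λ : Type*} [DecidableEq ι] [DecidableEq Λ] {P : SymProg ι Λ}
variable {V : Type*} [Fintype V] [DecidableEq V] {N T J : ℕ}
variable (AI : AtomIter P V N T J) (x : ι → Bool)

variable {AI x} {G : SimpleGraph V} [DecidableRel G.Adj] {col : V → ℕ} {A : Finset V}

omit [Fintype V] in
/-- `swReach` from a vertex outside the block is empty. [folklore] -/
theorem swReach_eq_empty_of_not_mem {B : Finset V} (c : V → ℕ) {v : V} (hv : v ∉ B) :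
    BranchSum.swReach G B c v = ∅ := by
  unfold BranchSum.swReach
  have h0 : ({v} ∩ B : Finset V) = ∅ := by
    rw [Finset.singleton_inter_of_notMem hv]
  rw [h0]
  have : ∀ n : ℕ, (BranchSum.swExpand G B c)^[n] (∅ : Finset V) = ∅ := by
    intro n
    induction n with
    | zero => rfl
    | succ n ih =>
      rw [Function.iterate_succ_apply', ih, BranchSum.swExpand, Finset.empty_union]
      refine Finset.filter_eq_empty_iff.2 fun b _ => ?_
      rintro ⟨a, ha, -⟩
      exact Finset.notMem_empty a ha
  exact this _

/-- **One round**: if the membership wires of round `j` read the block `B ⊆ A`, then "reachable from the pointer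
in round `j`" reads `swReach G B col ptr`. [folklore] -/
theorem sem_r_last_iff_swReach (hadj : ∀ a b, wval x (P.sem x) (AI.adj a b) = true ↔ G.Adj a b)
    (heq : ∀ a ∈ A, ∀ b ∈ A, wval x (P.sem x) (AI.eq a b) = true ↔ col a = col b)
    (hN : A.card ^ 2 ≤ N) (hT : A.card ≤ T) (j : Fin J)
    {B : Finset V} (hBA : B ⊆ A) (hmem : ∀ u, wval x (P.sem x) ((AI.sw j).mem u) = true ↔ u ∈ B) (u : V) :
    P.sem x ((AI.rch j).r (Fin.last T) AI.ptr u) = true ↔ u ∈ BranchSum.swReach G B col AI.ptr := by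
  classical
  set S := AI.sw j with hS
  set R := AI.rch j with hR
  -- the part of the switching gadget is `B`
  have hpart : S.part x = B := by
    ext w; rw [S.mem_part]; exact hmem w
  have hBcard : B.card ≤ A.card := card_le_card hBA
  -- the switching gadget reads the induced graph and colouring of its part
  have hreads : S.Reads x (G.induce ((S.part x : Finset V) : Set V)) (fun a => col a) :=
    { adj_iff := fun a b => by rw [show S.adj = AI.adj from AI.sw_adj j]; exact hadj a b
      eq_iff := fun a b => by
        rw [show S.eq = AI.eq from AI.sw_eq j]
        exact heq a (hBA (hpart ▸ a.2)) b (hBA (hpart ▸ b.2)) }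
  have hNS : (S.part x).card ^ 2 ≤ N := by
    rw [hpart]; exact le_trans (Nat.pow_le_pow_left hBcard 2) hN
  -- its output reads the switching graph of the block
  have hsw : ∀ {a b : V} (ha : a ∈ B) (hb : b ∈ B),
      P.sem x (S.sw a b) = true ↔ (BranchSum.swGraph G B col).Adj a b := by
    intro a b ha hb
    have ha' : a ∈ S.part x := hpart ▸ ha
    have hb' : b ∈ S.part x := hpart ▸ hb
    rw [Switching.sem_sw_iff hreads hNS ⟨a, ha'⟩ ⟨b, hb'⟩, ← hpart]
    exact (BranchSum.swGraph_adj_iff_induce (G := G) (S.part x) col ha' hb').symm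
  -- the reachability gadget: members and edges
  have hRmem : ∀ w, R.Mem x w ↔ w ∈ B := by
    intro w; show wval x (P.sem x) (R.mem w) = true ↔ _; rw [show R.mem w = S.mem w from AI.rch_mem j w]; exact hmem w
  have hEx : ∀ a b, R.Ex x a b ↔ (a ∈ B ∧ b ∈ B ∧ (BranchSum.swGraph G B col).Adj a b) := by
    intro a b
    show R.Mem x a ∧ R.Mem x b ∧ wval x (P.sem x) (R.edge a b) = true ↔ _
    rw [hRmem, hRmem, show R.edge a b = Sum.inr (S.sw a b) from AI.rch_edge j a b, wval_inr]
    constructor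
    · rintro ⟨ha, hb, hs⟩; exact ⟨ha, hb, (hsw ha hb).1 hs⟩
    · rintro ⟨ha, hb, hs⟩; exact ⟨ha, hb, (hsw ha hb).2 hs⟩
  have hExEq : R.Ex x = fun a b => a ∈ B ∧ b ∈ B ∧ (BranchSum.swGraph G B col).Adj a b :=
    funext fun a => funext fun b => propext (hEx a b)
  have hTR : (univ.filter fun w => R.Mem x w).card ≤ T := by
    have : (univ.filter fun w => R.Mem x w) = B := by
      ext w; simp only [mem_filter, mem_univ, true_and, hRmem]
    rw [this]; exact hBcard.trans hT
  rw [Reach.sem_r_last_iff (R := R) (x := x) hTR, hRmem, hExEq]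
  by_cases hptr : AI.ptr ∈ B
  · rw [BranchSum.mem_swReach_iff_reflTransGen col hptr]
    exact ⟨fun h' => h'.2, fun h' => ⟨hptr, h'⟩⟩
  · rw [swReach_eq_empty_of_not_mem col hptr]
    simp [hptr]

/-- **The membership wires entering round `j ≤ J` read the `j`-th iterate** of `B ↦ swReach G B col ptr`
from `A`. [folklore] -/
theorem memW_iff_iterate (hadj : ∀ a b, wval x (P.sem x) (AI.adj a b) = true ↔ G.Adj a b)
    (heq : ∀ a ∈ A, ∀ b ∈ A, wval x (P.sem x) (AI.eq a b) = true ↔ col a = col b)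
    (hmem0 : ∀ u, wval x (P.sem x) (AI.mem0 u) = true ↔ u ∈ A) (hN : A.card ^ 2 ≤ N) (hT : A.card ≤ T) :
    ∀ (j : ℕ) (hj : j < J + 1) (u : V), wval x (P.sem x) (AI.memW ⟨j, hj⟩ u) = true ↔
      u ∈ (fun B => BranchSum.swReach G B col AI.ptr)^[j] A := by
  intro j
  induction j with
  | zero =>
    intro hj u
    rw [show (⟨0, hj⟩ : Fin (J + 1)) = 0 from rfl, memW_zero, Function.iterate_zero, id_eq]
    exact hmem0 u
  | succ j ih =>
    intro hj u
    have hjJ : j < J := Nat.lt_of_succ_lt_succ hj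
    have hcast : (⟨j + 1, hj⟩ : Fin (J + 1)) = (⟨j, hjJ⟩ : Fin J).succ := rfl
    rw [hcast, memW_succ, wval_inr, Function.iterate_succ_apply']
    refine sem_r_last_iff_swReach hadj heq hN hT ⟨j, hjJ⟩ (BranchSum.iterate_atomStep_subset A col AI.ptr j)
      (fun w => ?_) u
    rw [sw_mem_eq]
    exact ih (Nat.lt_of_lt_of_le hjJ (Nat.le_succ J)) w

/-- **The output membership wires read the atom of the pointer**, once `J ≥ |A| + 1`. [folklore] -/
theorem memW_last_iff_atom (hadj : ∀ a b, wval x (P.sem x) (AI.adj a b) = true ↔ G.Adj a b)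
    (heq : ∀ a ∈ A, ∀ b ∈ A, wval x (P.sem x) (AI.eq a b) = true ↔ col a = col b)
    (hmem0 : ∀ u, wval x (P.sem x) (AI.mem0 u) = true ↔ u ∈ A) (hN : A.card ^ 2 ≤ N) (hT : A.card ≤ T)
    (hJ : A.card + 1 ≤ J) (u : V) :
    wval x (P.sem x) (AI.memW (Fin.last J) u) = true ↔ u ∈ BranchSum.atom G A col AI.ptr := by
  rw [show Fin.last J = ⟨J, Nat.lt_succ_self J⟩ from rfl, memW_iff_iterate hadj heq hmem0 hN hT]
  obtain ⟨n, hn, hfix⟩ := BranchSum.exists_atomStep_fixed (G := G) A col AI.ptr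
  unfold BranchSum.atom
  rw [BranchSum.iterate_atomStep_stable A col AI.ptr hfix J (by omega),
    BranchSum.iterate_atomStep_stable A col AI.ptr hfix (A.card + 1) (by omega)]

/-- The same from the bundled reading `AtomIter.Reads` (global kernel wires). [folklore] -/
theorem Reads.memW_last_iff_atom (h : AI.Reads x G col A) (hN : A.card ^ 2 ≤ N) (hT : A.card ≤ T)
    (hJ : A.card + 1 ≤ J) (u : V) :
    wval x (P.sem x) (AI.memW (Fin.last J) u) = true ↔ u ∈ BranchSum.atom G A col AI.ptr :=
  AtomIter.memW_last_iff_atom h.adj_iff (fun a _ b _ => h.eq_iff a b) h.mem0_iff hN hT hJ u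

end AtomIter

end Summit.PneNP.PneNP.Theorems
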